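import Summits.BirchSwinnertonDyer.BirchSwinnertonDyer.Theorems.ErratumRoadFiveNonSurjCornerKolyJProp44PairSelmer
import Summits.BirchSwinnertonDyer.BirchSwinnertonDyer.Theorems.ErratumRoadFiveNonSurjCornerKolyJProp44Ramified
import Summits.BirchSwinnertonDyer.BirchSwinnertonDyer.Theorems.Rank1ResidualJetCebotarevAdapter
import HarnessLib

/-!
# McCallum 1991 Prop. 4.4 «in particular» — `ord d_M(mℓ)_λ = ord c_M(mℓ)_λ = ord c_M(m)_λ` — at Zhang–Kolyvagin
# levels WITHOUT any image hypothesis, modulo the congruence (γ) for the pair: the BODY of the typed print fact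
# `McCallum1991.prop44_localOrder_kolyvaginClass_mul_eq` at `(E, K, p)` as a kernel theorem ⟸ {(γ), McCallum's
# standing inputs at the two levels} (cell `bsd-stepL`, seat `bsd-stepL-corner-p1` g10;
# `--supports stmt-BirchSwinnertonDyer-19947`; memo CORNER-G10 §1)

WHY/WHAT. The ONE corner-specific named input of `stub_kolyJ_max` (19947 ∕ 19065 `NonSurjCorner`; also the Upper kit
of 19111 `CornerAtThree` and the walk of 19109) is the typed print fact `McCallum1991.prop44_localOrder_kolyvaginClass_mul_eq`
(McCallumLMS1991 Prop. 4.4 «In particular, `ord d_M(ml)_λ = ord c_M(ml)_λ = ord c_M(m)_λ`»), consumed by bsd-jet's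
`JET.addOrderOf_localization_kolyvaginClass_mul_eq_of_prop44` (⇒ the walk's `h47`) and by
`McCallum1991.kolyvaginClass_mul_mem_torsionLocalKer_iff_of_prop44` (⇒ the swap's `h44c`); it carries the `p`-adic
TOWER SURJECTIVITY binder `∀ n, W.HasSurjectiveModNGaloisRep (p^n)` (and `¬CM`), void on the ¬Surj corner. THIS FILE
proves the fact's BODY at a given `(W, K, p)` — binders from `Dt` on VERBATIM those of the fact, conclusion VERBATIM —
WITHOUT `¬CM` and WITHOUT any image hypothesis, from: (γ) = Gross 1991 Prop. 3.7 (2) for the pair `(d', d)`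
(image-free PRINT, Eichler–Shimura; labelled `hγ`) and McCallum's two standing inputs at the two levels `m`, `mℓ`
(`hA`∕`hA'`: `E(K[·]) ⊆ E(K̄)` admissible for `p^M` — Gross Lemma 4.3 ∕ McCallum (5), a theorem under (irr) ∕ `p` odd
unramified in `K` (`X11b.NoTorsionIrr`); `hPt`∕`hPt'`: `[P(·)]` is `Γ_K`-invariant mod `p^M` — Gross Prop. 3.6 with 3.7 (1)).
Assembly of `Prop44.zsmul_kolyvaginClass_mem_selmerLocalKer_iff_of_compat` (the composite `ord d_M(mℓ)_λ = ord
c_M(m)_λ`, x11b3's `h44` programme re-keyed to Zhang primes and re-curried to compatible pairs) and the NEW kernel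
theorem `Prop44.zsmul_kolyvaginClass_mem_selmerLocalKer_iff_mem_torsionLocalKer_of_datum` (`ord d_M(mℓ)_λ = ord
c_M(mℓ)_λ`, McCallum 4.4 (3)). Corollaries in the consumers' currencies: `addOrderOf (loc_λ c_M(mℓ)) = addOrderOf
(loc_λ c_M(m))` (bsd-jet's adapter, its fact application replaced) and `c_M(mℓ)_λ = 0 ↔ c_M(m)_λ = 0` (`j = 0`).
HONEST FRAMING: conditional on (γ) (one PRINT fact, image-free) and on the standing inputs at two levels; nothing about
BSD; no stub closes; T7. The tree's `GrossLMS1991.prop37_2_reductionCongruence` (12:26Z, b2b-bsdres) carries Gross's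
§2 surjectivity binder and Gross-prime keys and does NOT supply (γ) on the corner.
References: [McCallumLMS1991] §4 Prop. 4.4 with «In particular», Lemma 4.3, (4)–(6) (pp. 299–302); [GrossLMS1991] Prop.
3.6, Prop. 3.7 (1)(2), Lemma 4.3, §4 (4.1), Prop. 6.2 (2), Prop. 9.6; [Jetchev2008] Prop. 4.7 = printed Prop. 4.4
(p. 821); [WZhang2014] Notations (xii).
-/

set_option autoImplicit false
set_option linter.dupNamespace false

noncomputable section

open scoped Classical
open WeierstrassCurve Field NumberField IsDedekindDomain Finset
open Literature.NumberTheory.EllipticCurves Literature.NumberTheory.GaloisRepresentations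
open Literature.NumberTheory.EllipticCurves.KolyvaginCocycle
open Literature.NumberTheory.EllipticCurves.RingClassField
open Literature.NumberTheory.EllipticCurves.ModularForms
open Literature.NumberTheory.GaloisCohomology
open Summit.BirchSwinnertonDyer.Rank1Residual.X11b

namespace Summit.BirchSwinnertonDyer.BirchSwinnertonDyer.Theorems.Prop44

-- `K : Type`: the tree's ring-class class field theory is universe `0`.
variable {K : Type} [Field K] [NumberField K] {W : WeierstrassCurve ℚ} [W.IsElliptic] [W.IsGloballyMinimal]
  [NeZero (W.conductorNorm ℤ)]

/-- **McCallum 1991 Prop. 4.4 «in particular» at Zhang–Kolyvagin levels, image-free, modulo (γ): the BODY of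
`McCallum1991.prop44_localOrder_kolyvaginClass_mul_eq` at `(W, K, p)`.** `E = W/ℚ` globally minimal of conductor
`N_E`, `K` imaginary quadratic with `d_K ∉ {−3, −4}` and the Heegner hypothesis, `p` odd — and NO hypothesis on the
image of `ρ_{E,p}` — then for every frame `(Dt, β, ι)`, `M ≥ 1`, square-free `mℓ` (`ℓ` prime, `ℓ ∤ m`) with Zhang–Kolyvagin
prime factors of index `≥ M`, compatible data `d` (conductor `m`), `d'` (conductor `mℓ`) (`hσ`, `hS₁`, `hS₂`, `hemb`
VERBATIM the fact's), GIVEN (γ) = Gross Prop. 3.7 (2) for the pair (`hγ`: `red(γ·y(mℓ)) = φ₀·red(γ·y(m)↑)` at the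
place over `ℓ`, every `γ ∈ Gal(K[mℓ]/K)`) and McCallum's standing inputs at both levels (`hA`, `hA'`, `hPt`, `hPt'`),
at the place `λ ∋ ℓ`, for every `j`: `p^j c_M(mℓ) ∈ Sel_λ ↔ p^j c_M(mℓ)_λ = 0` AND `p^j c_M(mℓ)_λ = 0 ↔ p^j c_M(m)_λ = 0`
(conclusion VERBATIM the fact's). [cite: McCallumLMS1991, §4 Prop. 4.4 «In particular» (p. 301), Lemma 4.3]
[cite: GrossLMS1991, Prop. 3.7 (2), Prop. 3.6, Prop. 6.2 (2), Prop. 9.6] [cite: WZhang2014, Notations (xii)] -/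
theorem localOrder_kolyvaginClass_mul_eq_of_congruence (hK : IsImaginaryQuadratic K)
    (hD3 : NumberField.discr K ≠ -3) (hD4 : NumberField.discr K ≠ -4)
    (hH : SatisfiesHeegnerHypothesis (W.conductorNorm ℤ) K) {p : ℕ} [Fact p.Prime] (hp2 : p ≠ 2)
    (Dt : ModularParametrizationData W (W.conductorNorm ℤ)) (β : ℤ) (ι : K →+* ℂ) (M : ℕ) (hM : 1 ≤ M)
    (m l : ℕ) (hsq : Squarefree (m * l)) (hl : l.Prime) (_hlm : ¬ l ∣ m)
    (hS : ∀ l' ∈ (m * l).primeFactors, Zhang2014.IsKolyvaginPrime (W.conductorNorm ℤ) W K p l' ∧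
      M ≤ Zhang2014.kolyvaginIndex W p l')
    (d : KolyvaginHeegnerData Dt β ι m) (d' : KolyvaginHeegnerData Dt β ι (m * l))
    (hσ : ∀ l' ∈ m.primeFactors, ∀ (x : ringClassField K ι m) (x' : ringClassField K ι (m * l)),
      (x : ℂ) = x' → ((d'.σ l' x' : ringClassField K ι (m * l)) : ℂ) = (d.σ l' x : ℂ))
    (hS₁ : ∀ s ∈ d.S, ∃ s' ∈ d'.S, ∀ (x : ringClassField K ι m) (x' : ringClassField K ι (m * l)),
      (x : ℂ) = x' → ((s' x' : ringClassField K ι (m * l)) : ℂ) = (s x : ℂ))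
    (hS₂ : ∀ s' ∈ d'.S, ∃ s ∈ d.S, ∀ (x : ringClassField K ι m) (x' : ringClassField K ι (m * l)),
      (x : ℂ) = x' → ((s' x' : ringClassField K ι (m * l)) : ℂ) = (s x : ℂ))
    (hemb : ∀ (x : ringClassField K ι m) (x' : ringClassField K ι (m * l)),
      (x : ℂ) = x' → d'.emb x' = d.emb x)
    (hγ : ∀ [Fact l.Prime] (hΔ : ¬ (l : ℤ) ∣ minimalDiscriminantInt W)
      (φ₀ : absoluteGaloisGroup (ZMod l)), (∀ x : AlgebraicClosure (ZMod l), φ₀ • x = x ^ l) →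
      ∀ (hle : ringClassField K ι m ≤ ringClassField K ι (m * l))
        (γ : ringClassField K ι (m * l) ≃ₐ[ℚ] ringClassField K ι (m * l)), γ ∈ ringClassGal ι (m * l) →
        geomReduction hΔ ((RatClosure.pointsEquiv (K := K) W).symm
            (d'.toGeomPoints (pointGalHom W (ringClassField K ι (m * l)) γ d'.y))) =
          φ₀ • geomReduction hΔ ((RatClosure.pointsEquiv (K := K) W).symm
            (d'.toGeomPoints (pointGalHom W (ringClassField K ι (m * l)) γ
              (WeierstrassCurve.Affine.Point.map (W' := W)
                (letI : Algebra K ℂ := ι.toAlgebra; (RingClassField.inclusion ι hle).restrictScalars ℚ)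
                d.y)))))
    (hA : IsAdmissible (absoluteGaloisGroup K) d.pointsSubgroup ((p ^ M : ℕ) : ℤ))
    (hA' : IsAdmissible (absoluteGaloisGroup K) d'.pointsSubgroup ((p ^ M : ℕ) : ℤ))
    (hPt : d.toGeomPoints d.derivedPoint ∈
      invPoints (absoluteGaloisGroup K) d.pointsSubgroup ((p ^ M : ℕ) : ℤ))
    (hPt' : d'.toGeomPoints d'.derivedPoint ∈
      invPoints (absoluteGaloisGroup K) d'.pointsSubgroup ((p ^ M : ℕ) : ℤ))
    (v : HeightOneSpectrum (𝓞 K)) (hv : (l : 𝓞 K) ∈ v.asIdeal) (j : ℕ) :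
    (((p ^ j : ℕ) : ℤ) • d'.kolyvaginClass (Fact.out : p.Prime) M ∈
        selmerLocalKer (W.baseChange K) (v.adicCompletion K) ((p ^ M : ℕ) : ℤ) ↔
      ((p ^ j : ℕ) : ℤ) • d'.kolyvaginClass (Fact.out : p.Prime) M ∈
        (W.baseChange K).torsionLocalKer (v.adicCompletion K) ((p ^ M : ℕ) : ℤ)) ∧
    (((p ^ j : ℕ) : ℤ) • d'.kolyvaginClass (Fact.out : p.Prime) M ∈
        (W.baseChange K).torsionLocalKer (v.adicCompletion K) ((p ^ M : ℕ) : ℤ) ↔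
      ((p ^ j : ℕ) : ℤ) • d.kolyvaginClass (Fact.out : p.Prime) M ∈
        (W.baseChange K).torsionLocalKer (v.adicCompletion K) ((p ^ M : ℕ) : ℤ)) := by
  have hp : p.Prime := Fact.out
  have hl' : l ∈ (m * l).primeFactors := Nat.mem_primeFactors.mpr ⟨hl, dvd_mul_left l m, hsq.ne_zero⟩
  have hmn : m * l / l = m := Nat.mul_div_cancel m hl.pos
  have hD : NumberField.discr K < -4 := KolyvaginAssembly.discr_lt_neg_four hK ⟨hD3, hD4⟩
  have h1 : ∀ k : ℤ, k • d'.kolyvaginClass hp M ∈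
        selmerLocalKer (W.baseChange K) (v.adicCompletion K) ((p ^ M : ℕ) : ℤ) ↔
      k • d'.kolyvaginClass hp M ∈ (W.baseChange K).torsionLocalKer (v.adicCompletion K) ((p ^ M : ℕ) : ℤ) :=
    fun k ↦ zsmul_kolyvaginClass_mem_selmerLocalKer_iff_mem_torsionLocalKer_of_datum hK ι hp hp2 hsq hS hl'
      d' hA' hPt' v hv k
  have h2 : ∀ a : ℕ, ((p : ℤ) ^ a) • d'.kolyvaginClass hp M ∈
        selmerLocalKer (W.baseChange K) (v.adicCompletion K) ((p ^ M : ℕ) : ℤ) ↔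
      ((p : ℤ) ^ a) • d.kolyvaginClass hp M ∈
        (W.baseChange K).torsionLocalKer (v.adicCompletion K) ((p ^ M : ℕ) : ℤ) :=
    fun a ↦ zsmul_kolyvaginClass_mem_selmerLocalKer_iff_of_compat hK ι hD hH Dt hp hp2 hM hsq hS hl' hmn d' d
      hσ hS₁ hS₂ hemb hγ hA' hA hPt' hPt v hv a
  have hpj : ((p ^ j : ℕ) : ℤ) = (p : ℤ) ^ j := by push_cast; rfl
  refine ⟨h1 _, ((h1 _).symm.trans ?_)⟩
  rw [hpj]
  exact h2 j

/-- **The walk's `h47` currency** — `addOrderOf (loc_λ c_M(mℓ)) = addOrderOf (loc_λ c_M(m))` (Jetchev 2008 Prop. 4.7 =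
McCallum Prop. 4.4 «ord c_M(mℓ)_λ = ord c_M(m)_λ»; bsd-jet's `JET.addOrderOf_localization_kolyvaginClass_mul_eq_of_prop44`
with its application of the print fact replaced by `localOrder_kolyvaginClass_mul_eq_of_congruence`): image-free,
modulo (γ) for the pair and the standing inputs at the two levels. [cite: Jetchev2008, Prop. 4.4 (p. 821) = arXiv
Prop. 4.7] [cite: McCallumLMS1991, §4 Prop. 4.4 (p. 301)] [cite: GrossLMS1991, Prop. 3.7 (2)] -/
theorem addOrderOf_localization_kolyvaginClass_mul_eq_of_congruence (hK : IsImaginaryQuadratic K)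
    (hD3 : NumberField.discr K ≠ -3) (hD4 : NumberField.discr K ≠ -4)
    (hH : SatisfiesHeegnerHypothesis (W.conductorNorm ℤ) K) {p : ℕ} [Fact p.Prime] (hp2 : p ≠ 2)
    (Dt : ModularParametrizationData W (W.conductorNorm ℤ)) (β : ℤ) (ι : K →+* ℂ) (M : ℕ) (hM : 1 ≤ M)
    (m l : ℕ) (hsq : Squarefree (m * l)) (hl : l.Prime) (hlm : ¬ l ∣ m)
    (hS : ∀ l' ∈ (m * l).primeFactors, Zhang2014.IsKolyvaginPrime (W.conductorNorm ℤ) W K p l' ∧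
      M ≤ Zhang2014.kolyvaginIndex W p l')
    (d : KolyvaginHeegnerData Dt β ι m) (d' : KolyvaginHeegnerData Dt β ι (m * l))
    (hσ : ∀ l' ∈ m.primeFactors, ∀ (x : ringClassField K ι m) (x' : ringClassField K ι (m * l)),
      (x : ℂ) = x' → ((d'.σ l' x' : ringClassField K ι (m * l)) : ℂ) = (d.σ l' x : ℂ))
    (hS₁ : ∀ s ∈ d.S, ∃ s' ∈ d'.S, ∀ (x : ringClassField K ι m) (x' : ringClassField K ι (m * l)),
      (x : ℂ) = x' → ((s' x' : ringClassField K ι (m * l)) : ℂ) = (s x : ℂ))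
    (hS₂ : ∀ s' ∈ d'.S, ∃ s ∈ d.S, ∀ (x : ringClassField K ι m) (x' : ringClassField K ι (m * l)),
      (x : ℂ) = x' → ((s' x' : ringClassField K ι (m * l)) : ℂ) = (s x : ℂ))
    (hemb : ∀ (x : ringClassField K ι m) (x' : ringClassField K ι (m * l)),
      (x : ℂ) = x' → d'.emb x' = d.emb x)
    (hγ : ∀ [Fact l.Prime] (hΔ : ¬ (l : ℤ) ∣ minimalDiscriminantInt W)
      (φ₀ : absoluteGaloisGroup (ZMod l)), (∀ x : AlgebraicClosure (ZMod l), φ₀ • x = x ^ l) →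
      ∀ (hle : ringClassField K ι m ≤ ringClassField K ι (m * l))
        (γ : ringClassField K ι (m * l) ≃ₐ[ℚ] ringClassField K ι (m * l)), γ ∈ ringClassGal ι (m * l) →
        geomReduction hΔ ((RatClosure.pointsEquiv (K := K) W).symm
            (d'.toGeomPoints (pointGalHom W (ringClassField K ι (m * l)) γ d'.y))) =
          φ₀ • geomReduction hΔ ((RatClosure.pointsEquiv (K := K) W).symm
            (d'.toGeomPoints (pointGalHom W (ringClassField K ι (m * l)) γ
              (WeierstrassCurve.Affine.Point.map (W' := W)
                (letI : Algebra K ℂ := ι.toAlgebra; (RingClassField.inclusion ι hle).restrictScalars ℚ)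
                d.y)))))
    (hA : IsAdmissible (absoluteGaloisGroup K) d.pointsSubgroup ((p ^ M : ℕ) : ℤ))
    (hA' : IsAdmissible (absoluteGaloisGroup K) d'.pointsSubgroup ((p ^ M : ℕ) : ℤ))
    (hPt : d.toGeomPoints d.derivedPoint ∈
      invPoints (absoluteGaloisGroup K) d.pointsSubgroup ((p ^ M : ℕ) : ℤ))
    (hPt' : d'.toGeomPoints d'.derivedPoint ∈
      invPoints (absoluteGaloisGroup K) d'.pointsSubgroup ((p ^ M : ℕ) : ℤ))
    (v : HeightOneSpectrum (𝓞 K)) (hv : (l : 𝓞 K) ∈ v.asIdeal) :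
    addOrderOf ((galoisCohomology.localization
        ((W.baseChange K).torsionGaloisModule ((p ^ M : ℕ) : ℤ)) (Sum.inr v) 1 :
          galH1Torsion (W.baseChange K) ((p ^ M : ℕ) : ℤ) →+ _)
        (d'.kolyvaginClass (Fact.out : p.Prime) M)) =
      addOrderOf ((galoisCohomology.localization
        ((W.baseChange K).torsionGaloisModule ((p ^ M : ℕ) : ℤ)) (Sum.inr v) 1 :
          galH1Torsion (W.baseChange K) ((p ^ M : ℕ) : ℤ) →+ _)
        (d.kolyvaginClass (Fact.out : p.Prime) M)) := by
  have hp : p.Prime := Fact.out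
  set loc : galH1Torsion (W.baseChange K) ((p ^ M : ℕ) : ℤ) →+
      galoisCohomology (((W.baseChange K).torsionGaloisModule ((p ^ M : ℕ) : ℤ)).toLocal (Sum.inr v)) 1 :=
    galoisCohomology.localization ((W.baseChange K).torsionGaloisModule ((p ^ M : ℕ) : ℤ)) (Sum.inr v) 1
    with hlocdef
  have hloc : ∀ (z : galH1Torsion (W.baseChange K) ((p ^ M : ℕ) : ℤ)) (j : ℕ), loc (p ^ j • z) = 0 ↔
      ((p ^ j : ℕ) : ℤ) • z ∈ (W.baseChange K).torsionLocalKer (v.adicCompletion K) ((p ^ M : ℕ) : ℤ) := by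
    intro z j
    haveI : CharZero (v.adicCompletion K) := charZero_of_injective_algebraMap (algebraMap K _).injective
    rw [hlocdef, natCast_zsmul, mem_torsionLocalKer_iff_res_eq_zero (W := W.baseChange K)
      (E := v.adicCompletion K) (pow_ne_zero M hp.ne_zero)]
    exact Iff.rfl
  have hkillL : ∀ z : galH1Torsion (W.baseChange K) ((p ^ M : ℕ) : ℤ), p ^ M • loc z = 0 := fun z ↦
    galoisCohomology.nsmul_eq_zero_of_forall
      (((W.baseChange K).torsionGaloisModule ((p ^ M : ℕ) : ℤ)).toLocal (Sum.inr v))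
      (fun T ↦ by
        have h := (W.baseChange K).natAbs_nsmul_geomTorsion T
        rwa [Int.natAbs_natCast] at h) (loc z)
  have h := localOrder_kolyvaginClass_mul_eq_of_congruence hK hD3 hD4 hH hp2 Dt β ι M hM m l hsq hl hlm hS d d'
    hσ hS₁ hS₂ hemb hγ hA hA' hPt hPt' v hv
  refine Summit.BirchSwinnertonDyer.Rank1Residual.JET.addOrderOf_eq_addOrderOf_of_forall_nsmul_eq_zero_iff hp
    (hkillL _) (hkillL _) fun j ↦ ?_
  rw [← map_nsmul, ← map_nsmul]
  exact (hloc _ j).trans ((h j).2.trans (hloc _ j).symm)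

/-- **The swap's `h44c` currency (`j = 0`)** — `c_M(mℓ)_λ = 0 ↔ c_M(m)_λ = 0` (the level-`p^M` form of Gross Prop.
6.2 (2); `McCallum1991.kolyvaginClass_mul_mem_torsionLocalKer_iff_of_prop44` with the print fact replaced):
image-free, modulo (γ) for the pair and the standing inputs. [cite: McCallumLMS1991, §4 Prop. 4.4 (p. 301)]
[cite: GrossLMS1991, Prop. 6.2 (2), Prop. 3.7 (2)] -/
theorem kolyvaginClass_mul_mem_torsionLocalKer_iff_of_congruence (hK : IsImaginaryQuadratic K)
    (hD3 : NumberField.discr K ≠ -3) (hD4 : NumberField.discr K ≠ -4)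
    (hH : SatisfiesHeegnerHypothesis (W.conductorNorm ℤ) K) {p : ℕ} [Fact p.Prime] (hp2 : p ≠ 2)
    (Dt : ModularParametrizationData W (W.conductorNorm ℤ)) (β : ℤ) (ι : K →+* ℂ) (M : ℕ) (hM : 1 ≤ M)
    (m l : ℕ) (hsq : Squarefree (m * l)) (hl : l.Prime) (hlm : ¬ l ∣ m)
    (hS : ∀ l' ∈ (m * l).primeFactors, Zhang2014.IsKolyvaginPrime (W.conductorNorm ℤ) W K p l' ∧
      M ≤ Zhang2014.kolyvaginIndex W p l')
    (d : KolyvaginHeegnerData Dt β ι m) (d' : KolyvaginHeegnerData Dt β ι (m * l))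
    (hσ : ∀ l' ∈ m.primeFactors, ∀ (x : ringClassField K ι m) (x' : ringClassField K ι (m * l)),
      (x : ℂ) = x' → ((d'.σ l' x' : ringClassField K ι (m * l)) : ℂ) = (d.σ l' x : ℂ))
    (hS₁ : ∀ s ∈ d.S, ∃ s' ∈ d'.S, ∀ (x : ringClassField K ι m) (x' : ringClassField K ι (m * l)),
      (x : ℂ) = x' → ((s' x' : ringClassField K ι (m * l)) : ℂ) = (s x : ℂ))
    (hS₂ : ∀ s' ∈ d'.S, ∃ s ∈ d.S, ∀ (x : ringClassField K ι m) (x' : ringClassField K ι (m * l)),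
      (x : ℂ) = x' → ((s' x' : ringClassField K ι (m * l)) : ℂ) = (s x : ℂ))
    (hemb : ∀ (x : ringClassField K ι m) (x' : ringClassField K ι (m * l)),
      (x : ℂ) = x' → d'.emb x' = d.emb x)
    (hγ : ∀ [Fact l.Prime] (hΔ : ¬ (l : ℤ) ∣ minimalDiscriminantInt W)
      (φ₀ : absoluteGaloisGroup (ZMod l)), (∀ x : AlgebraicClosure (ZMod l), φ₀ • x = x ^ l) →
      ∀ (hle : ringClassField K ι m ≤ ringClassField K ι (m * l))
        (γ : ringClassField K ι (m * l) ≃ₐ[ℚ] ringClassField K ι (m * l)), γ ∈ ringClassGal ι (m * l) →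
        geomReduction hΔ ((RatClosure.pointsEquiv (K := K) W).symm
            (d'.toGeomPoints (pointGalHom W (ringClassField K ι (m * l)) γ d'.y))) =
          φ₀ • geomReduction hΔ ((RatClosure.pointsEquiv (K := K) W).symm
            (d'.toGeomPoints (pointGalHom W (ringClassField K ι (m * l)) γ
              (WeierstrassCurve.Affine.Point.map (W' := W)
                (letI : Algebra K ℂ := ι.toAlgebra; (RingClassField.inclusion ι hle).restrictScalars ℚ)
                d.y)))))
    (hA : IsAdmissible (absoluteGaloisGroup K) d.pointsSubgroup ((p ^ M : ℕ) : ℤ))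
    (hA' : IsAdmissible (absoluteGaloisGroup K) d'.pointsSubgroup ((p ^ M : ℕ) : ℤ))
    (hPt : d.toGeomPoints d.derivedPoint ∈
      invPoints (absoluteGaloisGroup K) d.pointsSubgroup ((p ^ M : ℕ) : ℤ))
    (hPt' : d'.toGeomPoints d'.derivedPoint ∈
      invPoints (absoluteGaloisGroup K) d'.pointsSubgroup ((p ^ M : ℕ) : ℤ))
    (v : HeightOneSpectrum (𝓞 K)) (hv : (l : 𝓞 K) ∈ v.asIdeal) :
    d'.kolyvaginClass (Fact.out : p.Prime) M ∈
        (W.baseChange K).torsionLocalKer (v.adicCompletion K) ((p ^ M : ℕ) : ℤ) ↔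
      d.kolyvaginClass (Fact.out : p.Prime) M ∈
        (W.baseChange K).torsionLocalKer (v.adicCompletion K) ((p ^ M : ℕ) : ℤ) := by
  have h := (localOrder_kolyvaginClass_mul_eq_of_congruence hK hD3 hD4 hH hp2 Dt β ι M hM m l hsq hl hlm hS d d'
    hσ hS₁ hS₂ hemb hγ hA hA' hPt hPt' v hv 0).2
  simp only [pow_zero, Nat.cast_one, one_zsmul] at h
  exact h

end Summit.BirchSwinnertonDyer.BirchSwinnertonDyer.Theorems.Prop44

end
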